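import Summits.BirchSwinnertonDyer.BirchSwinnertonDyer.Theorems.PrintCf2SplitBadTwoUnrLocalDefectEngine
import Summits.BirchSwinnertonDyer.BirchSwinnertonDyer.Theorems.PrintCf2SplitBadTwoUnrCoinvariantsFrame
import Summits.BirchSwinnertonDyer.BirchSwinnertonDyer.Theorems.EisensteinPrimesAnomalousUnramifiedKernelFinite
import Summits.BirchSwinnertonDyer.BirchSwinnertonDyer.Theorems.PrintCf2SplitBadTwoLineDecompVbarTrivialEvenSeven
import Summits.BirchSwinnertonDyer.BirchSwinnertonDyer.Theorems.PrintCf2SplitBadTwoLineNoSplitPrimes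
import Summits.BirchSwinnertonDyer.BirchSwinnertonDyer.Theorems.PrintCf2SplitBadTwoLineDoubleCosetFrame
import Summits.BirchSwinnertonDyer.BirchSwinnertonDyer.Theorems.PrintCf2SplitBadTwoScalarSubOneSurjective
import Literature.NumberTheory.EllipticCurves.ZpExtensionSplitLineProofs
import Literature.NumberTheory.GaloisRepresentations.CocyclicScalarCharacter
import Literature.NumberTheory.GaloisRepresentations.IntegralGaloisActionProofs
import HarnessLib

/-!
# Crux `PrintCf2.SplitBadTwoRankOneOfFacts` (stmt-BirchSwinnertonDyer-20368), road α v13.1, stub S3d, CLASS (iii)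
# (`d ≡ 3 (mod 8)` or `d ≡ 14 (mod 16)`): h𝓛 DISCHARGED ON THE FRAME — `#(S_nr)_Γ = 1` UNCONDITIONALLY

Cell `bsd-print-cf2`, EXTRA WIDTH seat `bsd-line-cf2-p1-w4` gen 11 (`--supports stmt-BirchSwinnertonDyer-20368`; closes nothing; no summit
statement is proved here). The engine `localDefect_conj_sub_surjective_of_character` (file `…UnrLocalDefectEngine`, p694455) reduces the
displayed hypothesis h𝓛 of `natCard_endCoinvariants_conjUnr_eq_one_of_frame` (p692596) to five local inputs at `v̄`; here they are supplied
on the road-α frame on the whole class (iii), `hcl : d % 8 = 3 ∨ (2 ∣ d ∧ (d/2) % 8 = 7)` (`hL_of_frame_classThree`):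
(1) `D″ = D_v̄ ∩ ker κ'` acts trivially on `W*` — -w6 g4/g5's `RestrictedSelmerPair.smul_eq_self_of_mem_decomp_vbar_inf_kerSubgroup_of_frame_classThree`
(p685012 + p694089; this is where class (iii) enters);
(2) `W*` is `2`-primary; (3) the character `χ := κ|_{D_v̄}` of the PARTNER line `κ` unramified outside `v` — it EXISTS by the PROVED
class-field-theoretic `ZpExtension.exists_isUnramifiedOutside_of_split` (no named fact), kills `I_v̄` (`IsUnramifiedOutside.inertia_le`), and
is non-trivial on `D″`: `κ(D_v̄) ≠ 1` by (C1) `LineDecomposition.decomp_not_le_kerSubgroup_of_isUnramifiedOutside` (roles of `v, v̄`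
swapped), `κ'(I_v̄) ≠ 1` (`LineDoubleCoset.exists_mem_inertia_apply_ne_one_of_isUnramifiedOutside`), and `ℤ₂`-saturation of `κ'(I_v̄)`
(`AnomalousLocalTorsion.exists_mem_apply_toAdd_eq_of_dvd`) produces `g = d₂^{2^n} τ ∈ D″` with `κ g = κ(d₂)^{2^n} ≠ 1`;
(4) a topological generator of `D″` modulo `I″` — bsd-eis' `AnomalousLocalTorsion.exists_generator_decomp_inf_kerSubgroup` fed with an
arithmetic Frobenius (`exists_isArithFrobAt_of_mem_primesAbove_holds`) and the ramification of `κ'` at `v̄`;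
(5) `δ − 1` onto `W*` for `δ ∈ D_v̄ ∖ ker κ'`: `Γ_K` acts on `W*` through the continuous scalar character `ψ`
(`CocyclicScalar.exists_unitsHom_forall_smul_eq` on `CMPrimes.endEigenPrimaryTorsion_two_structure`), `ψ(δ) ≠ 1` by the (C3) iff
`mem_kerSubgroup_iff_smul_of_frame`, and -w8 g3's `ReductionKernel.exists_sub_eq_of_scalar_ne_one` (divisible `2`-primary line).
Consequences: `natCard_endCoinvariants_conjUnr_eq_one_of_frame_classThree[_of_finite]` — `#(S_nr)_Γ = 1` with NO displayed hypothesis on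
class (iii) (the `hcoinv` input of -w3 g11's socket `StrictDefect.valuation_eq_add_of_natCard_endCoinvariants_eq_one_endEigenPrimaryTorsion`).

Search: presearch «decomposition group of a prime above p in the Z_p^2 extension of an imaginary quadratic field has rank two / partner
Z_p-extension nontrivial on decomposition group» → [corpus: Greenberg1989 "Iwasawa theory for p-adic representations" §1; GreenbergVatsal2000
§2 p. 17 (finitely many primes of K_∞ above v̄)] — the tree's (C1) is the formal input; no new fact. [cite: GreenbergLNM1716, §2 Prop. 2.4]
[cite: GreenbergVatsal2000, §2 p. 17] [cite: Washington1997, §13.1] [cite: NeukirchANT1999, Ch. I §9 Prop. (9.4)] beyond-print theorem: no.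
BSD is not proved by any of this.
-/

noncomputable section

open scoped Classical

set_option linter.dupNamespace false
set_option autoImplicit false

open NumberField IsDedekindDomain Field WeierstrassCurve
open Literature.NumberTheory.EllipticCurves Literature.NumberTheory.EllipticCurves.GreenbergSelmer
open Literature.NumberTheory.EllipticCurves.GreenbergVatsal2000 Literature.NumberTheory.EllipticCurves.KellerYin2024
open Literature.NumberTheory.EllipticCurves.Agboola2007
open Literature.NumberTheory.EllipticCurves.IwasawaDual
open Literature.NumberTheory.GaloisRepresentations
open Summit.BirchSwinnertonDyer.Rank1Residual.X11b
open Summit.BirchSwinnertonDyer.BirchSwinnertonDyer.Theorems.PrintCf2.RestrictedSelmerPair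
open Summit.BirchSwinnertonDyer.BirchSwinnertonDyer.Theorems.PrintCf2.AdditiveAtSeven
open Summit.BirchSwinnertonDyer.BirchSwinnertonDyer.Theorems.PrintCf2.CMPrimes

namespace Summit.BirchSwinnertonDyer.BirchSwinnertonDyer.Theorems.PrintCf2.UnrBaseLift

variable {K : Type} [Field K] [NumberField K]

/-- **Input (3) on the frame: an element of `D″ = D_v̄ ∩ ker κ'` on which the partner line `κ` (unramified outside `v`) is non-trivial.**
`κ'` is ramified at `v̄` (`τ₁ ∈ I_v̄`, `κ' τ₁ ≠ 1`), `κ` is unramified at `v̄` and non-trivial on `D_v̄` ((C1), `d₂`); by `ℤ₂`-saturation of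
`κ'(I_v̄)` some `τ ∈ I_v̄` has `κ' τ = κ'(d₂)^{-2^n}`, and `g := d₂^{2^n} τ` works (`κ g = κ(d₂)^{2^n} ≠ 1`, `ℤ₂` torsion-free).
[cite: GreenbergVatsal2000, §2 p. 17] [cite: Washington1997, §13.1] -/
theorem exists_mem_decomp_inf_kerSubgroup_apply_ne_one (hK : IsImaginaryQuadratic K) {p : ℕ} [Fact p.Prime]
    {v vbar : HeightOneSpectrum (𝓞 K)} (hv : ((p : ℕ) : 𝓞 K) ∈ v.asIdeal) (hvbar : ((p : ℕ) : 𝓞 K) ∈ vbar.asIdeal) (hne : vbar ≠ v)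
    (κ' : ZpExtension K p) (hκ' : κ'.IsUnramifiedOutside vbar) (κ : ZpExtension K p) (hκ : κ.IsUnramifiedOutside v) :
    ∃ g : ↥(decomp (K := K) vbar), (g : absoluteGaloisGroup K) ∈ κ'.kerSubgroup ∧ Coinv.kappaD κ vbar g ≠ 1 := by
  have hp : p.Prime := Fact.out
  obtain ⟨d₁, hd₁I, hd₁⟩ := LineDoubleCoset.exists_mem_inertia_apply_ne_one_of_isUnramifiedOutside hK κ' hκ'
  have hC1 := LineDecomposition.decomp_not_le_kerSubgroup_of_isUnramifiedOutside hK hvbar hv hne.symm κ hκ (w := vbar) hne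
  obtain ⟨d₂, hd₂D, hd₂⟩ := SetLike.not_le_iff_exists.mp hC1
  obtain ⟨τ, hτI, hτ⟩ := AnomalousLocalTorsion.exists_mem_apply_toAdd_eq_of_dvd κ' (inertia vbar)
    (AnomalousLocalTorsion.isClosed_inertia' vbar) hd₁I hd₁
    (x := -((p : ℤ_[p]) ^ ((κ' d₁).toAdd).valuation * (κ' d₂).toAdd)) (Dvd.intro _ rfl).neg_right
  refine ⟨⟨d₂ ^ p ^ ((κ' d₁).toAdd).valuation * τ,
    (decomp vbar).mul_mem ((decomp vbar).pow_mem hd₂D _) (inertia_le_decomp vbar hτI)⟩, ?_, ?_⟩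
  · rw [ZpExtension.mem_kerSubgroup]
    apply Multiplicative.toAdd.injective
    rw [map_mul, toAdd_mul, map_pow, toAdd_pow, hτ, toAdd_one, nsmul_eq_mul, Nat.cast_pow, add_neg_cancel]
  · rw [Ne, Coinv.kappaD_apply]
    change ¬ κ (d₂ ^ p ^ ((κ' d₁).toAdd).valuation * τ) = 1
    have hτκ : κ τ = 1 := ZpExtension.mem_kerSubgroup.mp (hκ.inertia_le hne hτI)
    rw [map_mul, hτκ, mul_one, map_pow]
    intro h
    apply hd₂
    rw [ZpExtension.mem_kerSubgroup]
    have h2 : (p ^ ((κ' d₁).toAdd).valuation : ℕ) • (κ d₂).toAdd = 0 := by rw [← toAdd_pow, h, toAdd_one]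
    rw [nsmul_eq_mul] at h2
    rcases mul_eq_zero.mp h2 with h0 | h0
    · exact absurd (Nat.cast_eq_zero.mp h0) (pow_ne_zero _ hp.ne_zero)
    · rw [← ofAdd_toAdd (κ d₂), h0, ofAdd_zero]

/-- **Input (5) on the frame: `δ − 1` is onto `W*` for `δ ∈ D_v̄ ∖ ker κ'`** (indeed for any `δ ∈ Γ_K ∖ ker κ'`). `Γ_K` acts on the
cocyclic `2`-primary `W*` through a scalar character `ψ : Γ_K → ℤ₂ˣ` (`CocyclicScalar.exists_unitsHom_forall_smul_eq` on
`CMPrimes.endEigenPrimaryTorsion_two_structure`); `ψ δ ≠ 1` since otherwise `δ` fixes `W*` pointwise and lies in `ker κ'` by the (C3) iff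
`mem_kerSubgroup_iff_smul_of_frame`; and `σ − 1` is onto a divisible `2`-primary line on which `σ` is the scalar `c ≠ 1`
(`ReductionKernel.exists_sub_eq_of_scalar_ne_one`). [cite: GreenbergLNM1716, §2 Prop. 2.4 (p. 73)] [cite: Rubin1999, §3 Lemma 3.6 (ii)] -/
theorem exists_smul_sub_eq_of_not_mem_kerSubgroup_of_frame {d : ℤ} (hd0 : d ≠ 0) (W : WeierstrassCurve ℚ) [W.IsElliptic]
    (C : VariableChange ℚ) (hC : C • W = cm7.quadraticTwist (d : ℚ)) (hK : IsImaginaryQuadratic K)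
    {v vbar : HeightOneSpectrum (𝓞 K)} (hv : ((2 : ℕ) : 𝓞 K) ∈ v.asIdeal) (hvbar : ((2 : ℕ) : 𝓞 K) ∈ vbar.asIdeal) (hne : vbar ≠ v)
    (π : (W.baseChange K).endRing) (hrel : (π : AddMonoid.End (W.baseChange K).geomPoints) * π = π - 2) {r : ℤ_[2]} (hr : r * r = r - 2)
    (hpin : ∀ τ ∈ GreenbergSelmer.inertia v, ∀ x : ↥((W.baseChange K).endEigenPrimaryTorsion 2 π r), τ • x = x ∨ τ • x = -x)
    (κ' : ZpExtension K 2) (hκ' : κ'.IsUnramifiedOutside vbar) {δ : absoluteGaloisGroup K} (hδκ : δ ∉ κ'.kerSubgroup)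
    (m : ↥((W.baseChange K).endEigenPrimaryTorsion 2 π r)) :
    ∃ m' : ↥((W.baseChange K).endEigenPrimaryTorsion 2 π r), δ • m' - m' = m := by
  haveI : Fact (Nat.Prime 2) := ⟨Nat.prime_two⟩
  have hj : W.j = -3375 := j_eq_of_smul_eq_cm7Twist hd0 W C hC
  obtain ⟨θ, hθ⟩ := exists_sq_eq_neg_seven_of_cmEndo_mem_endRing W K hj π hrel
  obtain ⟨-, -, -, -, hdiv, -, hgenW, hscal⟩ := endEigenPrimaryTorsion_two_structure W hj K hθ π hrel hr
  have htor : ∀ x : ↥((W.baseChange K).endEigenPrimaryTorsion 2 π r), ∃ k : ℕ, 2 ^ k • x = 0 := exists_pow_smul_endEigenPrimaryTorsion_eq_zero (W.baseChange K) 2 π r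
  -- the scalar character
  have hscalT : ∀ (σ : absoluteGaloisGroup K) (k : ℕ), ∃ N : ℤ, ∀ x : ↥((W.baseChange K).endEigenPrimaryTorsion 2 π r), 2 ^ k • x = 0 → σ • x = N • x := by
    intro σ k
    obtain ⟨N, hN⟩ := hscal σ k
    refine ⟨N, fun x hx ↦ Subtype.ext ?_⟩
    have hx' : 2 ^ k • (x : (W.baseChange K).geomPrimaryTorsion 2) = 0 := by
      have := congrArg Subtype.val hx
      rwa [AddSubmonoidClass.coe_nsmul, ZeroMemClass.coe_zero] at this
    rw [endEigenPrimaryTorsion.coe_smul, AddSubgroupClass.coe_zsmul]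
    exact hN x x.2 hx'
  have hfull : ∀ k : ℕ, ∃ x : ↥((W.baseChange K).endEigenPrimaryTorsion 2 π r), addOrderOf x = 2 ^ k := by
    intro k
    obtain ⟨g, hg, hord, -⟩ := hgenW k
    refine ⟨⟨g, hg⟩, ?_⟩
    rw [← hord]
    exact (addOrderOf_injective ((W.baseChange K).endEigenPrimaryTorsion 2 π r).subtype Subtype.coe_injective ⟨g, hg⟩).symm
  obtain ⟨ψ, hψ⟩ := CocyclicScalar.exists_unitsHom_forall_smul_eq (p := 2) hscalT hfull
  have hval : ∀ (k : ℕ) (y : ℤ_[2]), (PadicInt.toZModPow k y).val = y.appr k := fun k y ↦ by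
    rw [toZModPow_eq_natCast_appr, ZMod.val_natCast, Nat.mod_eq_of_lt (PadicInt.appr_lt y k)]
  -- `ψ δ ≠ 1`
  have hc1 : (ψ δ : ℤ_[2]) ≠ 1 := by
    intro h1
    apply hδκ
    refine (mem_kerSubgroup_iff_smul_of_frame hd0 W C hC hK v vbar hv hvbar hne π hrel hr hpin κ' hκ' δ).mpr (Or.inl fun x ↦ ?_)
    obtain ⟨k, hk⟩ := htor x
    have h := hψ δ k x hk
    rw [h1, hval, appr_one_nsmul hk] at h
    exact h
  -- the graded scalar clause
  have hprim : ∀ y ∈ (W.baseChange K).endEigenPrimaryTorsion 2 π r, ∃ k : ℕ, 2 ^ k • y = 0 := fun y hy ↦ by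
    obtain ⟨k, hk⟩ := htor ⟨y, hy⟩
    refine ⟨k, ?_⟩
    have := congrArg Subtype.val hk
    rwa [AddSubmonoidClass.coe_nsmul, ZeroMemClass.coe_zero] at this
  have hscalar : ∀ (k : ℕ), ∀ x ∈ (W.baseChange K).endEigenPrimaryTorsion 2 π r, 2 ^ k • x = 0 →
      ∀ N : ℤ, ((N : ℤ_[2]) - (ψ δ : ℤ_[2])) ∈ (Ideal.span {(2 : ℤ_[2]) ^ k} : Ideal ℤ_[2]) →
        (DistribSMul.toAddMonoidHom ((W.baseChange K).geomPrimaryTorsion 2) δ) x = N • x := by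
    intro k x hx hxk N hN
    rw [DistribSMul.toAddMonoidHom_apply]
    have hxk' : 2 ^ k • (⟨x, hx⟩ : ↥((W.baseChange K).endEigenPrimaryTorsion 2 π r)) = 0 :=
      Subtype.ext (by rw [AddSubmonoidClass.coe_nsmul, hxk, ZeroMemClass.coe_zero])
    have h := hψ δ k ⟨x, hx⟩ hxk'
    rw [hval] at h
    have h' : δ • x = (ψ δ : ℤ_[2]).appr k • x := by
      have := congrArg Subtype.val h
      rwa [endEigenPrimaryTorsion.coe_smul, AddSubmonoidClass.coe_nsmul] at this
    rw [h']
    have hcong : ((N : ℤ_[2]) - ((((ψ δ : ℤ_[2]).appr k : ℕ) : ℤ) : ℤ_[2])) ∈ (Ideal.span {(2 : ℤ_[2]) ^ k} : Ideal ℤ_[2]) := by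
      have e : (N : ℤ_[2]) - ((((ψ δ : ℤ_[2]).appr k : ℕ) : ℤ) : ℤ_[2]) =
          ((N : ℤ_[2]) - (ψ δ : ℤ_[2])) + ((ψ δ : ℤ_[2]) - (((ψ δ : ℤ_[2]).appr k : ℕ) : ℤ_[2])) := by
        push_cast; ring
      rw [e]
      exact Ideal.add_mem _ hN (PadicInt.appr_spec k _)
    rw [ReductionKernel.zsmul_eq_zsmul_of_sub_mem_span' hxk hcong, natCast_zsmul]
  obtain ⟨y, hy, hyy⟩ := ReductionKernel.exists_sub_eq_of_scalar_ne_one ((W.baseChange K).endEigenPrimaryTorsion 2 π r) hprim hdiv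
    (DistribSMul.toAddMonoidHom ((W.baseChange K).geomPrimaryTorsion 2) δ) hc1 hscalar
    (m : (W.baseChange K).geomPrimaryTorsion 2) m.2
  refine ⟨⟨y, hy⟩, Subtype.ext ?_⟩
  rw [DistribSMul.toAddMonoidHom_apply] at hyy
  rw [AddSubgroupClass.coe_sub, endEigenPrimaryTorsion.coe_smul]
  exact hyy

/-- **h𝓛 ON THE FRAME, CLASS (iii) (`d ≡ 3 (mod 8)` or `d ≡ 14 (mod 16)`).** On the road-α frame of S3d (pinned at `v`, the line `κ'` unramified outside `v̄`),
for every `δ ∈ D_v̄ ∖ ker κ'` the map `conj_δ − 1` is ONTO the local defect group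
`𝓛 = ker (H¹(D_v̄ ∩ ker κ', W*) → H¹(ker κ' ∩ I_v̄, W*))` — VERBATIM the hypothesis `hL` of `natCard_endCoinvariants_conjUnr_eq_one_of_frame`
(p692596). The engine `localDefect_conj_sub_surjective_of_character` on the inputs (1)–(5) of the module docstring; the partner line comes
from the proved CFT theorem `ZpExtension.exists_isUnramifiedOutside_of_split`, so NO named fact is displayed.
[cite: GreenbergLNM1716, §2 Prop. 2.4 (p. 73)] [cite: GreenbergVatsal2000, §2 p. 17] [cite: JetchevSkinnerWan2017, Lemma 3.3.3] -/
theorem hL_of_frame_classThree {d : ℤ} (hd0 : d ≠ 0) (hcl : d % 8 = 3 ∨ ((2 : ℤ) ∣ d ∧ (d / 2) % 8 = 7)) (W : WeierstrassCurve ℚ) [W.IsElliptic]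
    (C : VariableChange ℚ) (hC : C • W = cm7.quadraticTwist (d : ℚ)) (hK : IsImaginaryQuadratic K)
    {v vbar : HeightOneSpectrum (𝓞 K)} (hv : ((2 : ℕ) : 𝓞 K) ∈ v.asIdeal) (hvbar : ((2 : ℕ) : 𝓞 K) ∈ vbar.asIdeal) (hne : vbar ≠ v)
    (π : (W.baseChange K).endRing) (hrel : (π : AddMonoid.End (W.baseChange K).geomPoints) * π = π - 2) {r : ℤ_[2]} (hr : r * r = r - 2)
    (hpin : ∀ τ ∈ GreenbergSelmer.inertia v, ∀ x : ↥((W.baseChange K).endEigenPrimaryTorsion 2 π r), τ • x = x ∨ τ • x = -x)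
    (κ' : ZpExtension K 2) (hκ' : κ'.IsUnramifiedOutside vbar) :
    ∀ δ : decomp (K := K) vbar, (δ : absoluteGaloisGroup K) ∉ κ'.kerSubgroup →
      ∀ a : subgroupH1 (Coinv.kerD κ' vbar) ↥((W.baseChange K).endEigenPrimaryTorsion 2 π r),
        resH1Hom (Coinv.toKerD κ' vbar (kerSubgroup_inf_inertia_le_decomp κ' vbar)
            (inf_le_left : κ'.kerSubgroup ⊓ inertia vbar ≤ κ'.kerSubgroup))
          (AddMonoidHom.id ↥((W.baseChange K).endEigenPrimaryTorsion 2 π r)) (fun _ _ ↦ rfl) a = 0 →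
        ∃ ℓ : subgroupH1 (Coinv.kerD κ' vbar) ↥((W.baseChange K).endEigenPrimaryTorsion 2 π r),
          resH1Hom (Coinv.toKerD κ' vbar (kerSubgroup_inf_inertia_le_decomp κ' vbar)
              (inf_le_left : κ'.kerSubgroup ⊓ inertia vbar ≤ κ'.kerSubgroup))
            (AddMonoidHom.id ↥((W.baseChange K).endEigenPrimaryTorsion 2 π r)) (fun _ _ ↦ rfl) ℓ = 0 ∧
          conjH1 (Coinv.kerD κ' vbar) ↥((W.baseChange K).endEigenPrimaryTorsion 2 π r) δ ℓ - ℓ = a := by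
  haveI : Fact (Nat.Prime 2) := ⟨Nat.prime_two⟩
  set M := ↥((W.baseChange K).endEigenPrimaryTorsion 2 π r) with hM
  -- (1) `D″` acts trivially on `W*`
  have hD : ∀ g : absoluteGaloisGroup K, g ∈ decomp vbar → g ∈ κ'.kerSubgroup → ∀ m : M, g • m = m :=
    fun g hgD hgκ m ↦ smul_eq_self_of_mem_decomp_vbar_inf_kerSubgroup_of_frame_classThree hd0 hcl W C hC hK v vbar hv hvbar hne π hrel hr
      hpin κ' hκ' hgD hgκ m
  -- (2) `W*` is `2`-primary
  have htor : ∀ m : M, ∃ k : ℕ, 2 ^ k • m = 0 := exists_pow_smul_endEigenPrimaryTorsion_eq_zero (W.baseChange K) 2 π r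
  -- (3) the partner line, unramified at `v̄`, non-trivial on `D″`
  obtain ⟨κ, hκ⟩ := ZpExtension.exists_isUnramifiedOutside_of_split (p := 2) hK hv hvbar hne
  have hχI : ∀ g : ↥(decomp (K := K) vbar), (g : absoluteGaloisGroup K) ∈ inertia vbar →
      (g : absoluteGaloisGroup K) ∈ κ'.kerSubgroup → Coinv.kappaD κ vbar g = 1 := fun g hgI _ ↦ by
    rw [Coinv.kappaD_apply]
    exact ZpExtension.mem_kerSubgroup.mp (hκ.inertia_le hne hgI)
  have hχD := exists_mem_decomp_inf_kerSubgroup_apply_ne_one hK hv hvbar hne κ' hκ' κ hκ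
  -- (4) a topological generator of `D″` modulo `I″`
  obtain ⟨d₁, hd₁I, hd₁⟩ := LineDoubleCoset.exists_mem_inertia_apply_ne_one_of_isUnramifiedOutside hK κ' hκ'
  obtain ⟨φ, hφ⟩ := HeightOneSpectrum.exists_isArithFrobAt_of_mem_primesAbove_holds (K := K) (v := vbar)
    (adicCompletionPrime_mem_primesAbove K vbar)
  have hγ := AnomalousLocalTorsion.exists_generator_decomp_inf_kerSubgroup κ' hφ ⟨d₁, hd₁I, hd₁⟩
  -- (5) `δ − 1` onto `W*`
  have hδ : ∀ δ : decomp (K := K) vbar, (δ : absoluteGaloisGroup K) ∉ κ'.kerSubgroup →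
      ∀ m : M, ∃ m' : M, δ • m' - m' = m := fun δ hδκ m ↦
    exists_smul_sub_eq_of_not_mem_kerSubgroup_of_frame hd0 W C hC hK hv hvbar hne π hrel hr hpin κ' hκ' hδκ m
  exact localDefect_conj_sub_surjective_of_character κ' M vbar hD htor (Coinv.kappaD κ vbar) hχI hχD hγ hδ

/-- **`#(S_nr)_Γ = 1` ON THE FRAME, CLASS (iii), NO DISPLAYED HYPOTHESIS** (given the finiteness of the strict base group, e.g. from
(FIN)): `natCard_endCoinvariants_conjUnr_eq_one_of_frame_of_local` (p692596) with `hL := hL_of_frame_classThree`. This is the `hcoinv`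
input of -w3 g11's class-(iii) socket `StrictDefect.valuation_eq_add_of_natCard_endCoinvariants_eq_one_endEigenPrimaryTorsion`.
[cite: GreenbergVatsal2000, §2 Prop. 2.1, Cor. 2.3] [cite: GreenbergLNM1716, §4 Prop. 4.9 (no finite Λ-submodules)] -/
theorem natCard_endCoinvariants_conjUnr_eq_one_of_frame_classThree_of_finite {d : ℤ} (hd0 : d ≠ 0) (hcl : d % 8 = 3 ∨ ((2 : ℤ) ∣ d ∧ (d / 2) % 8 = 7))
    (W : WeierstrassCurve ℚ) [W.IsElliptic] [W.IsGloballyMinimal] (C : VariableChange ℚ) (hC : C • W = cm7.quadraticTwist (d : ℚ))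
    (hK : IsImaginaryQuadratic K) {v vbar : HeightOneSpectrum (𝓞 K)} (hv : ((2 : ℕ) : 𝓞 K) ∈ v.asIdeal)
    (hvbar : ((2 : ℕ) : 𝓞 K) ∈ vbar.asIdeal) (hne : vbar ≠ v)
    (π : (W.baseChange K).endRing) (hrel : (π : AddMonoid.End (W.baseChange K).geomPoints) * π = π - 2) {r : ℤ_[2]} (hr : r * r = r - 2)
    (hpin : ∀ τ ∈ GreenbergSelmer.inertia v, ∀ x : ↥((W.baseChange K).endEigenPrimaryTorsion 2 π r), τ • x = x ∨ τ • x = -x)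
    (κ' : ZpExtension K 2) (hκ' : κ'.IsUnramifiedOutside vbar) {γ' : absoluteGaloisGroup K} (hγ' : κ'.IsTopGenerator γ')
    (hfinB : Finite (restrictedSelmerBase ↥((W.baseChange K).endEigenPrimaryTorsion 2 π r) 2 vbar)) :
    Nat.card (EndCoinvariants
      (conjUnr κ' ↥((W.baseChange K).endEigenPrimaryTorsion 2 π r) vbar ∅ γ' - 1)) = 1 :=
  natCard_endCoinvariants_conjUnr_eq_one_of_frame_of_local hd0 W C hC hK hv hvbar hne π hrel hr κ' hκ' hγ' hfinB
    (hL_of_frame_classThree hd0 hcl W C hC hK hv hvbar hne π hrel hr hpin κ' hκ')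

/-- **`#(S_nr)_Γ = 1` ON S3d's FRAME (v13.1 binders), CLASS (iii), NO DISPLAYED HYPOTHESIS**: `natCard_endCoinvariants_conjUnr_eq_one_of_frame`
(p692596; (FIN) from cf2c-w2's `RelaxationLift.finite_restrictedSelmerBase_of_frame`) with `hL := hL_of_frame_classThree`. Plugs BY NAME into
-w3 g11's socket (`hcoinv`). [cite: GreenbergVatsal2000, §2 Prop. 2.1, Cor. 2.3] [cite: GreenbergLNM1716, §4 Prop. 4.9] -/
theorem natCard_endCoinvariants_conjUnr_eq_one_of_frame_classThree
    {d : ℤ} (hd0 : d ≠ 0) (hsq : Squarefree d) (hd4 : d % 4 ≠ 1) (hcl : d % 8 = 3 ∨ ((2 : ℤ) ∣ d ∧ (d / 2) % 8 = 7))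
    (W : WeierstrassCurve ℚ) [W.IsElliptic] [W.IsGloballyMinimal] (C : VariableChange ℚ)
    (hC : C • W = cm7.quadraticTwist (d : ℚ)) (hrank : W.analyticRank = 1) (hsha : Finite W.sha)
    (hK : IsImaginaryQuadratic K) {v vbar : HeightOneSpectrum (𝓞 K)}
    (hv : ((2 : ℕ) : 𝓞 K) ∈ v.asIdeal) (hvbar : ((2 : ℕ) : 𝓞 K) ∈ vbar.asIdeal) (hne : vbar ≠ v)
    (π : (W.baseChange K).endRing) (hrel : (π : AddMonoid.End (W.baseChange K).geomPoints) * π = π - 2)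
    {r : ℤ_[2]} (hr : r * r = r - 2)
    (hpin : ∀ τ ∈ GreenbergSelmer.inertia v, ∀ x : ↥((W.baseChange K).endEigenPrimaryTorsion 2 π r), τ • x = x ∨ τ • x = -x)
    (κ' : ZpExtension K 2) (hκ' : κ'.IsUnramifiedOutside vbar) {γ' : absoluteGaloisGroup K} (hγ' : κ'.IsTopGenerator γ')
    (P : W.toAffine.Point) (c₀ : ℕ) (ℓ : ℤ) (hP : ¬ IsOfFinAddOrder P)
    (hgen : ∀ R : W.toAffine.Point, ∃ (k : ℤ) (T : W.toAffine.Point), IsOfFinAddOrder T ∧ R = k • P + T)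
    (hc₀ : c₀ ≠ 0) (hker : (W.baseChange ℚ_[2]).IsInReductionKernel (c₀ • W.toPadicPoint 2 P))
    (hlog : ‖(W.baseChange ℚ_[2]).padicLogPoint (c₀ • W.toPadicPoint 2 P) / (c₀ : ℚ_[2])‖ = (2 : ℝ) ^ (-ℓ)) :
    Nat.card (EndCoinvariants
      (conjUnr κ' ↥((W.baseChange K).endEigenPrimaryTorsion 2 π r) vbar ∅ γ' - 1)) = 1 :=
  natCard_endCoinvariants_conjUnr_eq_one_of_frame hd0 hsq hd4 W C hC hrank hsha hK hv hvbar hne π hrel hr hpin κ' hκ' hγ'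
    P c₀ ℓ hP hgen hc₀ hker hlog (hL_of_frame_classThree hd0 hcl W C hC hK hv hvbar hne π hrel hr hpin κ' hκ')

end Summit.BirchSwinnertonDyer.BirchSwinnertonDyer.Theorems.PrintCf2.UnrBaseLift

end
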